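import Summits.HodgeConjecture.HodgeConjecture.Theorems.K2E3RegularAdjointExpansion   -- ★ p855766 (K2E1b-p08): (L6-inst) FILE 2 `exists_pos_pos_forall_mul_norm_le_of_separable`; brings FILE 1 p855727 (`isCompl_range_ker_ad`, `exists_bound_of_linearMap`, `projection_conj_eq`, `exists_pos_forall_le_norm_sub_of_isNilpotent`, `isUltrametricDist_matrix`)
import HarnessLib

/-!
# Crux `H413` — K2-LIT E3 «EllipticInputs», U12-h brick (L6-GL): THE CONE PACKAGE at a regular element — the `hL6` binder of ★ p855853 `exists_nhds_levelTraceStable_of_bricks_defect`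
# for `𝔤 = M_N(K)`, `Ad x = X ↦ (e x) X (e x)⁻¹`, `𝒩 = {nilpotent}`, from ★ (L6-inst) p855727 ∕ p855766

Cell `hodgecm-mathlib`, Track B «K2-LIT», crux item `stmt-HodgeConjecture-24833` (h413), line `K2_E3_EllipticInputs`, unit U12 «HC characters», socket U12-h
`sig_K2E3CharLocConstNearRegular` (‹#9L›).  Seat K2E3-p09 (g2), 9L line lead; row (L6-GL) of memo v5 `K2/K2E3-p09/g2/MEMO-U12h-frame-assembly.v5.K2E3-p09-g2.md`;
`--supports stmt-HodgeConjecture-24833 --as helper`.  THEOREMS ONLY — no `def`, no named fact, no instance, no notation, no `sorry`.  GENERIC: `K` a complete ultrametric perfect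
non-trivially normed field with proper closed balls (a local field), `N : ℕ`, a group hom `e : G →* GL_N(K)` (the one-place model), `γ ∈ G` with `e γ` regular semisimple (separable
characteristic polynomial).  HONEST LABEL: HC_CM is proved only modulo the 7 printed citations (2 remaining named inputs: hLiu418 = stmt-HodgeConjecture-24832, h413 =
stmt-HodgeConjecture-24833) until rung 0 closes; count-neutral packaging.

THE MATHEMATICS ([HarishChandra1999] §18 `𝔤 = 𝔪 + 𝔮`, §19 (2) p. 82, Lemma 19.3; memo v4 §1 (C4)).  `𝔤 = M_N(K) = 𝔱 ⊕ 𝔮` with `𝔱 = ker(ad eγ)`, `𝔮 = range(ad eγ)` (★ `isCompl_range_ker_ad`);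
`pq` := the projection onto `𝔮` along `𝔱` (Mathlib `Submodule.projection`): (1) `X − pq X ∈ 𝔱` (`sub_projection_mem`); (2) `pq` commutes with `Ad(y)` for `y = γ t`, `t` commuting with
`γ` (★ `projection_conj_eq`); (3) `cst‖pq X‖ ≤ ‖Ad(y)(pq X) − pq X‖` with `cst := min c 1`, `c = c(γ)` of ★ p855766, for `‖e t − 1‖ < δ`, `‖(e t)⁻¹‖ ≤ 1`; (4) `‖pq X‖ ≤ C‖X‖`
(★ `exists_bound_of_linearMap`); (5) the cone gap `ε` between nilpotents of norm `1` and `𝔱` (★ `exists_pos_forall_le_norm_sub_of_isNilpotent`).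
* **`exists_conePackage`** — the five clauses packaged in the binder shape of `hL6` (per admissible `t`), with `0 < cst ≤ 1`, `0 ≤ C`, `0 < ε`, `0 < δ`.

## References
* [HarishChandra1999] Harish-Chandra (notes by S. DeBacker and P. J. Sally, Jr.), *Admissible Invariant Distributions on Reductive p-adic Groups*, ULECT 16, AMS (1999): §18, §19 (2),
  Lemma 19.3.
* [BoschGuntzerRemmert1984] S. Bosch, U. Güntzer, R. Remmert, *Non-Archimedean Analysis* (1984), §1.2.1 (ultrametric norms).
-/

set_option autoImplicit false
-- the mandated namespace repeats `HodgeConjecture.HodgeConjecture`, as in every `Theorems/*.lean` of this sub-problem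
set_option linter.dupNamespace false

noncomputable section

open scoped MatrixGroups Matrix.Norms.Elementwise
open Summit.HodgeConjecture.HodgeConjecture.Cruxes.H413

namespace Summit.HodgeConjecture.HodgeConjecture.Cruxes.H413.K2E3ConePackageGL

variable {K : Type*} [NontriviallyNormedField K] [CompleteSpace K] [IsUltrametricDist K] [PerfectField K] [ProperSpace K] {N : ℕ}
  {G : Type*} [Group G] (e : G →* GL (Fin N) K)

/-- **THE CONE PACKAGE (binder `hL6` of ★ p855853) for `𝔤 = M_N(K)`, `Ad x X = (e x) X (e x)⁻¹`, `𝒩 = {Z | IsNilpotent Z}` at a regular semisimple `e γ`.**  There are an additive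
projection `pq` (onto `𝔮 = range(ad eγ)` along `𝔱 = ker(ad eγ)`), the submodule `𝔱`, constants `0 < cst ≤ 1`, `0 ≤ C`, `0 < ε` and a radius `0 < δ` such that for every `t ∈ G` with
`e t` commuting with `e γ`, `‖e t − 1‖ < δ` and `‖(e t)⁻¹‖ ≤ 1`, the element `y := γ t` satisfies: `X − pq X ∈ 𝔱`; `pq (Ad y X) = Ad y (pq X)`; `cst‖pq X‖ ≤ ‖Ad y (pq X) − pq X‖`;
`‖pq X‖ ≤ C‖X‖`; and `ε ≤ ‖Y − Z‖` for nilpotent `Y` of norm `1` and `Z ∈ 𝔱` (★ p855727 §§2–5, ★ p855766). [cite: HarishChandra1999, §18, §19 (2), Lemma 19.3] -/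
theorem exists_conePackage (γ : G) (hγ : ((e γ : GL (Fin N) K) : Matrix (Fin N) (Fin N) K).charpoly.Separable) :
    ∃ (pq : Matrix (Fin N) (Fin N) K →+ Matrix (Fin N) (Fin N) K) (𝔱 : Submodule K (Matrix (Fin N) (Fin N) K)) (cst C ε δ : ℝ),
      0 < cst ∧ cst ≤ 1 ∧ 0 ≤ C ∧ 0 < ε ∧ 0 < δ ∧
      ∀ t : G, ((e t : GL (Fin N) K) : Matrix (Fin N) (Fin N) K) * ((e γ : GL (Fin N) K) : Matrix (Fin N) (Fin N) K) =
          ((e γ : GL (Fin N) K) : Matrix (Fin N) (Fin N) K) * ((e t : GL (Fin N) K) : Matrix (Fin N) (Fin N) K) →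
        ‖((e t : GL (Fin N) K) : Matrix (Fin N) (Fin N) K) - 1‖ < δ → ‖(((e t)⁻¹ : GL (Fin N) K) : Matrix (Fin N) (Fin N) K)‖ ≤ 1 →
        (∀ X, X - pq X ∈ 𝔱) ∧
        (∀ X, pq (((e (γ * t) : GL (Fin N) K) : Matrix (Fin N) (Fin N) K) * X * (((e (γ * t))⁻¹ : GL (Fin N) K) : Matrix (Fin N) (Fin N) K)) =
          ((e (γ * t) : GL (Fin N) K) : Matrix (Fin N) (Fin N) K) * pq X * (((e (γ * t))⁻¹ : GL (Fin N) K) : Matrix (Fin N) (Fin N) K)) ∧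
        (∀ X, cst * ‖pq X‖ ≤ ‖((e (γ * t) : GL (Fin N) K) : Matrix (Fin N) (Fin N) K) * pq X * (((e (γ * t))⁻¹ : GL (Fin N) K) : Matrix (Fin N) (Fin N) K) - pq X‖) ∧
        (∀ X, ‖pq X‖ ≤ C * ‖X‖) ∧
        (∀ Y : Matrix (Fin N) (Fin N) K, IsNilpotent Y → ‖Y‖ = 1 → ∀ Z ∈ 𝔱, ε ≤ ‖Y - Z‖) := by
  haveI : IsUltrametricDist (Matrix (Fin N) (Fin N) K) := K2E3RegularAdjointConeEstimates.isUltrametricDist_matrix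
  set γM : Matrix (Fin N) (Fin N) K := ((e γ : GL (Fin N) K) : Matrix (Fin N) (Fin N) K) with hγM
  have hcompl := K2E3RegularAdjointConeEstimates.isCompl_range_ker_ad γM hγ
  set 𝔮 := LinearMap.range (LinearMap.mulLeft K γM - LinearMap.mulRight K γM)
  set 𝔱 := LinearMap.ker (LinearMap.mulLeft K γM - LinearMap.mulRight K γM)
  -- the constants
  obtain ⟨c, hc, δ, hδ, hcT⟩ := K2E3RegularAdjointExpansion.exists_pos_pos_forall_mul_norm_le_of_separable (e γ) hγ
  obtain ⟨C, hC, hpq⟩ := K2E3RegularAdjointConeEstimates.exists_bound_of_linearMap (𝔮.projection 𝔱 hcompl)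
  obtain ⟨ε, hε, hsep⟩ := K2E3RegularAdjointConeEstimates.exists_pos_forall_le_norm_sub_of_isNilpotent γM hγ
  refine ⟨(𝔮.projection 𝔱 hcompl).toAddMonoidHom, 𝔱, min c 1, C, ε, δ, lt_min hc one_pos, min_le_right _ _, hC, hε, hδ, fun t htγ htδ ht1 => ⟨?_, ?_, ?_, ?_, ?_⟩⟩
  · exact fun X => Submodule.sub_projection_mem hcompl X
  · intro X
    have hg : ((e (γ * t) : GL (Fin N) K) : Matrix (Fin N) (Fin N) K) * γM = γM * ((e (γ * t) : GL (Fin N) K) : Matrix (Fin N) (Fin N) K) := by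
      rw [map_mul, Units.val_mul, hγM, Matrix.mul_assoc, htγ, ← Matrix.mul_assoc]
    exact K2E3RegularAdjointConeEstimates.projection_conj_eq γM hcompl (e (γ * t)) hg X
  · intro X
    have hmem : 𝔮.projection 𝔱 hcompl X ∈ 𝔮 := Submodule.projection_apply_mem hcompl X
    have h := hcT (e t) htδ ht1 _ hmem
    rw [map_mul]
    exact (mul_le_mul_of_nonneg_right (min_le_left c 1) (norm_nonneg _)).trans h
  · exact fun X => hpq X
  · exact fun Y hY hY1 Z hZ => hsep Y hY hY1 Z hZ

end Summit.HodgeConjecture.HodgeConjecture.Cruxes.H413.K2E3ConePackageGL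

end
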